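import Summits.BirchSwinnertonDyer.Rank1Residual.AdditivePotMult.ModelFree
import Summits.BirchSwinnertonDyer.Rank1Residual.AdditivePotMult.GreenbergVatsalTwist
import Literature.NumberTheory.EllipticCurves.Milne1972.WeilRestrictionQuadraticBSDQuotientAnyModel
import HarnessLib

/-!
# X3♯(M) / X4(M): the CLASS THEOREMS on the canonical model `W.baseChange K` (model-free over-`K` input)

HONEST FRAMING (cell `b2b-bsdres`, run/shared/lean/b2b/bsd-rank1-residual/, verbatim in every
file): the goal of the cell is to DELETE the COMBINATION-SHAPED residual classes of the
Birch–Swinnerton-Dyer formula for ALL analytic-rank `≤ 1` elliptic curves over `ℚ` — "full BSD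
formula for every rank `≤ 1` curve in class `C`" assembled STRICTLY from published theorems — so
that the rank-`≤ 1` remainder becomes exactly the CONSTRUCTION-SHAPED classes, which are TYPED
(missing-input `Prop`s), NOT attempted. This is not "finishing BSD". Sub-cell
`b2b-bsdres-additive-p1` (CLASS-OWNERS row "X3/X4 additive — pot. multiplicative / X3♯(M)"),
generation 2; research route, no claim beyond the stated sub-classes; X3♯(M), X4(M) REMAIN
CONSTRUCTION-SHAPED.

Theorems only. `ModelFree.lean` types the over-`K` input on any `K`-model `V` of `E_K`
(`MissingPPartOverCAt V p`, Dokchitser–Dokchitser's `C(E/K)` = `modifiedTamagawaProduct`) and proves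
the descent with the Weil-restriction identity as a hypothesis `hWR`. Here `V = W.baseChange K` (the
CANONICAL model: no choice, no globally minimal `K`-model, no condition on the class of the prime
above `p` in `Cl(K)`) and `hWR` is discharged from the Literature named fact
`Milne1972.bsdQuotient_baseChange_quadratic_anyModel` (`hMilneC`; Milne 1972 Thm. 1 via
Dokchitser–Dokchitser 2010 §2.1 with `C(E/K)` for the differential of the model):

* `bsdp_of_pPartOverC_baseChange` — DESCENT: `MissingPPartOverCAt (W.baseChange K) p → BSDp Wd p → BSDp W p`
  (any `p`; `W`, `Wd` of analytic rank `≤ 1`);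
* `missingPPartOverCAt_baseChange_iff_bsdp` — EXACTNESS: given `BSD(Wd,p)`, the input ⟺ `BSD(W,p)`;
* **`bsdp_of_classX4M_of_rankZero_twist'`** — X4(M)⁰ (the `p`-multiplicative twist `E^{(d_K)}` has
  `L ≠ 0` at `1` and (ram), COVERED by Skinner 2016 Thm. C): `BSD(E,p) ⇐ MissingPPartOverCAt (W.baseChange K) p`
  ALONE — gen-0 census: such `K = ℚ(√D)`, `p ∣ D`, `|D| ≤ 40p`, exists for 1666 ‖ 397 of the
  1754 ‖ 418 X4(M) pairs (`N < 2·10⁴ ‖ 10⁴`), against 1410 ‖ 331 with the globally-minimal-model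
  phrasing of `ClassTheorems.lean`;
* **`bsdp_of_classX3M_of_gvPar_rankZero_twist'`** — X3♯(M) with a rank-0 gvpar twist (an X2a pair,
  closed by the X2 owner): likewise ALONE;
* `bsdp_of_classX4M_of_lowerOverC_of_kim` — X4(M)⁰ ∩ {`r_an = 0`, `p ≥ 5`, `ρ̄` onto, `p ∤ c_D·∏c_ℓ`}:
  ONE inequality `MissingLowerBoundOverCAt (W.baseChange K) p` suffices (upper half: Kim 2026).

All other inputs are published theorems carried as named-fact binders. The located gap is unchanged
(`ClassTheorems.lean`, `OneSided.lean`): the over-`K` input at a prime ramified in `K` is printed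
nowhere.
-/

noncomputable section

open scoped Classical

open WeierstrassCurve Literature.NumberTheory.EllipticCurves
  Literature.NumberTheory.EllipticCurves.ModularForms
  Literature.NumberTheory.EllipticCurves.Rank1Residual
  Literature.NumberTheory.EllipticCurves.Rank1Residual.Typed
  Literature.NumberTheory.EllipticCurves.GreenbergVatsal2000
  Literature.NumberTheory.EllipticCurves.Wuthrich2014
  Literature.NumberTheory.EllipticCurves.SteinWuthrich2013

namespace Summit.BirchSwinnertonDyer.Rank1Residual.AdditivePotMult

section BaseChange

variable (W : WeierstrassCurve ℚ) [W.IsElliptic] [W.IsGloballyMinimal] (p : ℕ) [Fact p.Prime]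
  (K : Type) [Field K] [NumberField K]
  (Wd : WeierstrassCurve ℚ) [Wd.IsElliptic] [Wd.IsGloballyMinimal]

/-- **Descent on the canonical model, Milne discharged.** For `W/ℚ` globally minimal of analytic
rank `≤ 1`, `K` quadratic and `Wd` a globally minimal model of `W^{(d_K)}` of analytic rank `≤ 1`
with `BSD(Wd,p)`: `MissingPPartOverCAt (W.baseChange K) p → BSDp W p` — the model-free
Weil-restriction identity and the finiteness of `Ш(E_K)` from the Literature named fact
`Milne1972.bsdQuotient_baseChange_quadratic_anyModel` (`hMilneC`), finiteness over `ℚ` from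
Gross–Zagier–Kolyvagin (`hGZK`). No `K`-model is chosen: no class-group condition. [folklore] -/
theorem bsdp_of_pPartOverC_baseChange
    (hGZK : rank_eq_analyticRank_of_analyticRank_le_one) (hmod : hasEntireLFunction_rat)
    (hMilneC : Milne1972.bsdQuotient_baseChange_quadratic_anyModel)
    (hr : W.analyticRank ≤ 1) (h2 : Module.finrank ℚ K = 2)
    (hWd : ∃ C : VariableChange ℚ, C • W.quadraticTwist (NumberField.discr K : ℚ) = Wd)
    (hrd : Wd.analyticRank ≤ 1)
    (hK : MissingPPartOverCAt (W.baseChange K) p) (hd : BSDp Wd p) : BSDp W p := by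
  haveI : (W.baseChange K).IsElliptic := by rw [baseChange]; infer_instance
  have hV : ∃ C : VariableChange K, C • W.baseChange K = W.baseChange K := ⟨1, one_smul _ _⟩
  obtain ⟨-, hfinW⟩ := hGZK W hr
  obtain ⟨-, hfinD⟩ := hGZK Wd hrd
  obtain ⟨hshaK, hWR⟩ := hMilneC W K h2 Wd hWd (W.baseChange K) hV hfinW hfinD
  exact bsdp_of_pPartOverC_of_bsdp_twist W p K Wd (W.baseChange K) hGZK hmod hr h2 hWd hrd hV hshaK
    hWR hK hd

/-- **Exactness on the canonical model**: with `BSD(Wd,p)`, `MissingPPartOverCAt (W.baseChange K) p ↔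
BSDp W p` (Milne any-model `hMilneC`, GZK, modularity; any `p`). [folklore] -/
theorem missingPPartOverCAt_baseChange_iff_bsdp
    (hGZK : rank_eq_analyticRank_of_analyticRank_le_one) (hmod : hasEntireLFunction_rat)
    (hMilneC : Milne1972.bsdQuotient_baseChange_quadratic_anyModel)
    (hr : W.analyticRank ≤ 1) (h2 : Module.finrank ℚ K = 2)
    (hWd : ∃ C : VariableChange ℚ, C • W.quadraticTwist (NumberField.discr K : ℚ) = Wd)
    (hrd : Wd.analyticRank ≤ 1) (hd : BSDp Wd p) :
    MissingPPartOverCAt (W.baseChange K) p ↔ BSDp W p := by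
  haveI : (W.baseChange K).IsElliptic := by rw [baseChange]; infer_instance
  have hV : ∃ C : VariableChange K, C • W.baseChange K = W.baseChange K := ⟨1, one_smul _ _⟩
  obtain ⟨-, hfinW⟩ := hGZK W hr
  obtain ⟨-, hfinD⟩ := hGZK Wd hrd
  obtain ⟨hshaK, hWR⟩ := hMilneC W K h2 Wd hWd (W.baseChange K) hV hfinW hfinD
  exact missingPPartOverCAt_iff_bsdp W p K Wd (W.baseChange K) hGZK hmod hr h2 hWd hrd hV hshaK hWR hd

/-- **X4(M)⁰, model-free — the sharpest form of the conversion.** For `(E,p) ∈ X4(M)` of analytic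
rank `≤ 1` and a quadratic field `K` such that a globally minimal model `Wd` of the twist `E^{(d_K)}`
is MULTIPLICATIVE at `p`, has `L(E^{(d_K)},1) ≠ 0` and (ram): **`BSD(E,p)` follows from
`MissingPPartOverCAt (W.baseChange K) p` ALONE** — the `p`-part of BSD for `E` over `K`, stated on
the base-changed model with Dokchitser–Dokchitser's `C(E/K)`; NO globally minimal `K`-model and NO
condition on the class of the prime above `p` (gen-0 census: this admits 1666 ‖ 397 of the
1754 ‖ 418 X4(M) pairs instead of 1410 ‖ 331). Inputs: Milne 1972 any-model (`hMilneC`), Skinner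
2016 Thm. C (`hSk`), GZK (`hGZK`), modularity (`hmod`). X4(M) stays CONSTRUCTION-SHAPED. [folklore] -/
theorem bsdp_of_classX4M_of_rankZero_twist'
    (hGZK : rank_eq_analyticRank_of_analyticRank_le_one) (hmod : hasEntireLFunction_rat)
    (hMilneC : Milne1972.bsdQuotient_baseChange_quadratic_anyModel)
    (hSk : Skinner2016.thmC_padicValRat_bsd_rank_zero)
    (hX : ClassX4M W p) (hr : W.analyticRank ≤ 1) (h2 : Module.finrank ℚ K = 2)
    (hWd : ∃ C : VariableChange ℚ, C • W.quadraticTwist (NumberField.discr K : ℚ) = Wd)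
    (hmult : Mult Wd p) (hram : Ram Wd p) (hr0 : Wd.analyticRank = 0)
    (hK : MissingPPartOverCAt (W.baseChange K) p) : BSDp W p := by
  have hD : (NumberField.discr K : ℚ) ≠ 0 := by exact_mod_cast NumberField.discr_ne_zero K
  obtain ⟨hp2, -, hirrd⟩ := mult_irr_twist_of_classX4M hX hD hWd hmult
  have hd : BSDp Wd p := bsdp_twist_of_rankZero_ram p Wd hSk hGZK hmod hp2 hmult hirrd hram hr0
  exact bsdp_of_pPartOverC_baseChange W p K Wd hGZK hmod hMilneC hr h2 hWd
    (by rw [hr0]; exact zero_le_one) hK hd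

/-- **X3♯(M) with a rank-zero Greenberg–Vatsal twist, model-free.** For `(E,p) ∈ X3♯(M)` of
analytic rank `≤ 1` and a quadratic field `K` such that a globally minimal model `Wd` of
`E^{(d_K)}` is multiplicative at `p`, has `L(E^{(d_K)},1) ≠ 0` and satisfies gvpar:
**`BSD(E,p) ⇐ MissingPPartOverCAt (W.baseChange K) p` ALONE** (the twist is an X2a pair, closed by
the X2 owner's `X2.bsdp_of_classX2_of_gvPar_of_analyticRank_eq_zero`: Greenberg–Vatsal 2000 `hGV`
[flag `GV00-mult-asserted`], Wuthrich Thm. 16 `hWu`, Stein–Wuthrich `hJs hJn hHs hHn`,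
Greenberg–Stevens `hGS`; Milne any-model `hMilneC`; GZK; modularity). No class-group condition.
X3♯(M) stays CONSTRUCTION-SHAPED. [folklore] -/
theorem bsdp_of_classX3M_of_gvPar_rankZero_twist' (hGV : lambdaMu_multiplicative_of_gvPar)
    (hWu : thm16_charIdeal_dvd_multiplicative_of_reducible)
    (hJs : thm61_splitMultiplicative) (hJn : thm61_nonsplitMultiplicative)
    (hHs : exists_isSplitMultCanonical) (hHn : exists_isMultCanonical)
    (hGZK : rank_eq_analyticRank_of_analyticRank_le_one) (hmod : hasEntireLFunction_rat)
    (hpar : nonempty_modularParametrizationData)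
    (hMilneC : Milne1972.bsdQuotient_baseChange_quadratic_anyModel)
    (hGS : greenberg_stevens (W := Wd) (p := p))
    (hX : ClassX3M W p) (hr : W.analyticRank ≤ 1) (h2 : Module.finrank ℚ K = 2)
    (hWd : ∃ C : VariableChange ℚ, C • W.quadraticTwist (NumberField.discr K : ℚ) = Wd)
    (hmult : Mult Wd p) (hgv : GVPar Wd p) (hr0 : Wd.analyticRank = 0)
    (hK : MissingPPartOverCAt (W.baseChange K) p) : BSDp W p := by
  have hD : (NumberField.discr K : ℚ) ≠ 0 := by exact_mod_cast NumberField.discr_ne_zero K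
  obtain ⟨hp2, hred, -⟩ := classX2_twist_of_classX3M hX hD hWd hmult
  have hd : BSDp Wd p :=
    bsdp_twist_of_rankZero_gvPar p Wd hGV hWu hJs hJn hHs hHn hGZK hmod hpar hGS hp2 hmult hred hgv hr0
  exact bsdp_of_pPartOverC_baseChange W p K Wd hGZK hmod hMilneC hr h2 hWd
    (by rw [hr0]; exact zero_le_one) hK hd

/-- **X4(M)⁰ ∩ {`r_an = 0`, `p ≥ 5`, `ρ̄` onto, `p ∤ c_D·∏c_ℓ`}, model-free and one-sided**:
`MissingLowerBoundOverCAt (W.baseChange K) p → BSDp W p` — ONE inequality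
`ord_p #Ш_an(E_K/K) ≤ ord_p #Ш(E_K/K)` on the base-changed model, the upper half being Kim 2026
Thm. 1.8 (6) (`hKim`, additive-p4's `X4RankZero.bsdp_of_missingLowerBoundAt`), the twist Skinner 2016
Thm. C (`hSk`), the identity Milne any-model (`hMilneC`). [folklore] -/
theorem bsdp_of_classX4M_of_lowerOverC_of_kim
    (hKim : Kim2026.rankZero_padicValNat_sha_le_of_maninConstant)
    (hGZK : rank_eq_analyticRank_of_analyticRank_le_one) (hmod : hasEntireLFunction_rat)
    (hMilneC : Milne1972.bsdQuotient_baseChange_quadratic_anyModel)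
    (hSk : Skinner2016.thmC_padicValRat_bsd_rank_zero)
    (hX : ClassX4M W p) (hp5 : 5 ≤ p) (hrW : W.analyticRank = 0) (hsurj : Surj W p)
    {N : ℕ} [NeZero N] (D : ModularParametrizationData W N) (hc : ¬ (p : ℤ) ∣ D.maninConstant)
    (htam : ¬ p ∣ W.tamagawaProduct) (h2 : Module.finrank ℚ K = 2)
    (hWd : ∃ C : VariableChange ℚ, C • W.quadraticTwist (NumberField.discr K : ℚ) = Wd)
    (hmult : Mult Wd p) (hram : Ram Wd p) (hr0 : Wd.analyticRank = 0)
    (hlow : MissingLowerBoundOverCAt (W.baseChange K) p) : BSDp W p := by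
  haveI : (W.baseChange K).IsElliptic := by rw [baseChange]; infer_instance
  have hV : ∃ C : VariableChange K, C • W.baseChange K = W.baseChange K := ⟨1, one_smul _ _⟩
  have hD : (NumberField.discr K : ℚ) ≠ 0 := by exact_mod_cast NumberField.discr_ne_zero K
  obtain ⟨hp2, -, hirrd⟩ := mult_irr_twist_of_classX4M hX hD hWd hmult
  have hd : BSDp Wd p := bsdp_twist_of_rankZero_ram p Wd hSk hGZK hmod hp2 hmult hirrd hram hr0
  obtain ⟨-, hfinW⟩ := hGZK W (by rw [hrW]; exact zero_le_one)
  obtain ⟨-, hfinD⟩ := hGZK Wd (by rw [hr0]; exact zero_le_one)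
  obtain ⟨hshaK, hWR⟩ := hMilneC W K h2 Wd hWd (W.baseChange K) hV hfinW hfinD
  have hlowQ : MissingLowerBoundAt W p :=
    (missingLowerBoundAt_iff_overC W p K Wd (W.baseChange K) hmod h2 hWd hV hfinW hfinD hshaK hWR
      hd).mpr hlow
  exact Additive.X4RankZero.bsdp_of_missingLowerBoundAt W p hKim hGZK hmod hp5 hrW hX.1 hsurj D hc
    htam hlowQ

end BaseChange

end Summit.BirchSwinnertonDyer.Rank1Residual.AdditivePotMult

end
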